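import Literature.MathematicalPhysics.QuantumManyBody.GeneralizedPoincareProofs
import HarnessLib

/-!
# Route `BECThomsonPrinciple`, crux `GDTransfer` (stmt-AtomisticToContinuum-9482), line `seeded-continuity`
# (skeleton v6): the periodic Sobolev inequality `H¹(cell) ⊂ L⁶(cell)` on the 3-torus

Helper file of the stub `stub_pairPotentialBound` (the measurable TRANSPORT device of the line, statement
`PairPotentialBound` of `…SeededTransportDefs.lean`).  For every side `L > 0` there is a constant
`C(L) < ∞` such that for every `Lℤ³`-periodic `C¹` function `f : ℝ³ → ℂ`

* `(∫_cell |f|⁶)^{1/3} ≤ C(L) (∫_cell |∇f|² + ∫_cell |f|²)` (`TorusSobolev.exists_lintegral_rpow_six_le`), and hence,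
  by Hölder with exponents `3/2` and `3`,
* `∫_cell W |f|² ≤ (∫_cell W^{3/2})^{2/3} · C(L) (∫_cell |∇f|² + ∫_cell |f|²)` for every measurable weight
  `W ≥ 0` on the cell (`torusSobolev_weight_bound`, the registered main theorem of this file).

Proof: the cut-off Gagliardo–Nirenberg–Sobolev template of `GenPoincare.poincare_sobolev_torus`
(`GeneralizedPoincareProofs.lean`, there with `p = 6/5 → 2`), here with `p = 2 → 6`: apply Mathlib's
`MeasureTheory.eLpNorm_le_eLpNorm_fderiv_of_eq_inner` (`n = 3`) to `u = χ_L • f` with the tree's cutoff `χ_L`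
(`= 1` on the cell, supported in the big box `[-L,2L)³`); pointwise `‖Du‖ ≤ 1_{[-L,2L)³}(|∇f| + (M/L)|f|)`
(`GenPoincare.enorm_fderiv_cutoff_smul_le` with mean `0`), and the big box consists of `27` lattice translates
of the cell, over each of which the periodic integrand has the same integral (`GenPoincare.lintegral_bigBox_le`).

References: LiebLoss2001 Thm. 8.3 (Sobolev inequality for gradients); LSSY2005 Lemma 4.1 (the cut-off /
periodicity bookkeeping, as in the tree template).
-/

noncomputable section

open MeasureTheory Filter Set
open scoped ENNReal NNReal

namespace Summit.AtomisticToContinuum.BoseEinsteinCondensation.Cruxes.GDTransfer.Seeded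

open Literature.MathematicalPhysics.QuantumManyBody.BoseGas
open Literature.MathematicalPhysics.QuantumManyBody.BoseGas.GenPoincare

namespace TorusSobolev

variable {L : ℝ}

/-- `|∇f|² = gradSqC f` for the gradient modulus `gradNorm f = (gradSqC f)^{1/2}`. [folklore] -/
theorem gradNorm_sq (f : Space → ℂ) (x : Space) : gradNorm f x ^ 2 = gradSqC f x := by
  have h := gradNorm_rpow f x 2
  rw [show ((2 : ℝ) / 2) = 1 by norm_num, ENNReal.rpow_one] at h
  rw [← h, ← ENNReal.rpow_natCast]
  norm_num

/-- `gradSqC` of a periodic function is periodic under the lattice. [folklore] -/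
theorem gradSqC_periodic {f : Space → ℂ}
    (hper : ∀ (x : Space) (k : Fin 3), f (x + EuclideanSpace.single k L) = f x)
    (x : Space) (n : Fin 3 → ℤ) : gradSqC f (x - latticeVec L n) = gradSqC f x := by
  simp only [gradSqC, fderiv_periodic hper]

/-- **The squared derivative of the cut-off function.** For `u = χ_L f`:
`‖Du(x)‖² ≤ 1_{[-L,2L)³}(x) · 2 (|∇f|²(x) + (M/L)² |f(x)|²)`. [folklore] -/
theorem sq_enorm_fderiv_cutoff_smul_le (hL : 0 < L) {f : Space → ℂ} (hf : ContDiff ℝ 1 f)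
    {M : ℝ} (hM : ∀ y : Space, ‖fderiv ℝ (unitCutoff : Space → ℝ) y‖ ≤ M) (x : Space) :
    ‖fderiv ℝ (fun y => cutoff L y • f y) x‖ₑ ^ 2 ≤
      (bigBox L).indicator
        (fun x => 2 * (gradSqC f x + ENNReal.ofReal (M * L⁻¹) ^ 2 * ‖f x‖ₑ ^ 2)) x := by
  have h := enorm_fderiv_cutoff_smul_le hL hf 0 hM x
  simp only [sub_zero] at h
  -- `(a + b)² ≤ 2 (a² + b²)` (pattern of `FourierProductLaw.ennreal_add_sq_le_two_mul`)
  have hsq : ∀ a b : ℝ≥0∞, (a + b) ^ 2 ≤ 2 * (a ^ 2 + b ^ 2) := fun a b => by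
    have h2 := ENNReal.rpow_add_le_mul_rpow_add_rpow a b (p := 2) (by norm_num)
    norm_num at h2
    exact_mod_cast h2
  by_cases hx : x ∈ bigBox L
  · rw [indicator_of_mem hx] at h
    rw [indicator_of_mem hx]
    calc ‖fderiv ℝ (fun y => cutoff L y • f y) x‖ₑ ^ 2
        ≤ (gradNorm f x + ENNReal.ofReal (M * L⁻¹) * ‖f x‖ₑ) ^ 2 := by gcongr
      _ ≤ 2 * (gradNorm f x ^ 2 + (ENNReal.ofReal (M * L⁻¹) * ‖f x‖ₑ) ^ 2) := hsq _ _
      _ = 2 * (gradSqC f x + ENNReal.ofReal (M * L⁻¹) ^ 2 * ‖f x‖ₑ ^ 2) := by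
          rw [gradNorm_sq, mul_pow]
  · rw [indicator_of_notMem hx] at h
    rw [indicator_of_notMem hx]
    have h0 : ‖fderiv ℝ (fun y => cutoff L y • f y) x‖ₑ = 0 := le_antisymm h bot_le
    rw [h0]
    simp

/-- **The `L²` norm of `Du` is controlled by the `H¹` norm of `f` on one cell**:
`∫ ‖Du‖² ≤ 2 · 27 · (∫_cell |∇f|² + (M/L)² ∫_cell |f|²)` for `u = χ_L f` and `f` periodic (pointwise bound
and periodicity over the `27` cells of `[-L,2L)³`). [folklore] -/
theorem lintegral_sq_enorm_fderiv_cutoff_smul_le (hL : 0 < L) {f : Space → ℂ} (hf : ContDiff ℝ 1 f)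
    (hper : ∀ (x : Space) (k : Fin 3), f (x + EuclideanSpace.single k L) = f x)
    {M : ℝ} (hM : ∀ y : Space, ‖fderiv ℝ (unitCutoff : Space → ℝ) y‖ ≤ M) :
    ∫⁻ x, ‖fderiv ℝ (fun y => cutoff L y • f y) x‖ₑ ^ 2 ≤
      2 * (shifts.card : ℝ≥0∞) *
        ((∫⁻ x in cell L, gradSqC f x) +
          ENNReal.ofReal (M * L⁻¹) ^ 2 * ∫⁻ x in cell L, ‖f x‖ₑ ^ 2) := by
  set c : ℝ≥0∞ := ENNReal.ofReal (M * L⁻¹) with hc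
  set H : Space → ℝ≥0∞ := fun x => 2 * (gradSqC f x + c ^ 2 * ‖f x‖ₑ ^ 2) with hH
  have hfm : Measurable fun x => ‖f x‖ₑ ^ 2 := hf.continuous.measurable.enorm.pow_const _
  have hgm : Measurable (gradSqC f) := Dyson.measurable_gradSqC hf
  have hHm : Measurable H := measurable_const.mul (hgm.add (measurable_const.mul hfm))
  have hHper : ∀ (x : Space) (n : Fin 3 → ℤ), H (x - latticeVec L n) = H x := fun x n => by
    simp only [hH, gradSqC_periodic hper, periodic_sub_latticeVec hper]
  calc ∫⁻ x, ‖fderiv ℝ (fun y => cutoff L y • f y) x‖ₑ ^ 2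
      ≤ ∫⁻ x, (bigBox L).indicator H x :=
        lintegral_mono fun x => sq_enorm_fderiv_cutoff_smul_le hL hf hM x
    _ = ∫⁻ x in bigBox L, H x := lintegral_indicator (measurableSet_bigBox L) _
    _ ≤ (shifts.card : ℝ≥0∞) * ∫⁻ x in cell L, H x := lintegral_bigBox_le hL hHm hHper
    _ = (shifts.card : ℝ≥0∞) * (2 * ((∫⁻ x in cell L, gradSqC f x) +
          c ^ 2 * ∫⁻ x in cell L, ‖f x‖ₑ ^ 2)) := by
        rw [hH, lintegral_const_mul' _ _ ENNReal.ofNat_ne_top, lintegral_add_left hgm,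
          lintegral_const_mul' _ _ (ENNReal.pow_ne_top ENNReal.ofReal_ne_top)]
    _ = _ := by ring

/-- **Periodic Sobolev inequality `H¹ ⊂ L⁶` on the 3-torus.** For `L > 0` there is `C < ∞`
(`C = 54 · C_GNS² · (1 + (M/L)²)`, `C_GNS` Mathlib's Gagliardo–Nirenberg–Sobolev constant for `p = 2`, `n = 3`,
`M` a bound of the derivative of the unit cutoff) such that for every `Lℤ³`-periodic `C¹` function `f : ℝ³ → ℂ`
`(∫_cell |f|⁶)^{1/3} ≤ C (∫_cell |∇f|² + ∫_cell |f|²)` (GNS with `p = 2`, `p* = 6`, `n = 3` applied to `χ_L f`).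
[cite: LiebLoss2001, Thm. 8.3] -/
theorem exists_lintegral_rpow_six_le (hL : 0 < L) : ∃ C : ℝ≥0∞, C ≠ ⊤ ∧ ∀ f : Space → ℂ, ContDiff ℝ 1 f →
    (∀ (x : Space) (k : Fin 3), f (x + EuclideanSpace.single k L) = f x) →
    (∫⁻ x in cell L, (‖f x‖₊ : ℝ≥0∞) ^ (6 : ℝ)) ^ ((1 : ℝ) / 3) ≤
      C * ((∫⁻ x in cell L, gradSqC f x) + ∫⁻ x in cell L, (‖f x‖₊ : ℝ≥0∞) ^ 2) := by
  obtain ⟨M, -, hM⟩ := exists_bound_fderiv_unitCutoff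
  set CG : ℝ≥0 := MeasureTheory.eLpNormLESNormFDerivOfEqInnerConst (volume : Measure Space) 2 with hCG
  set c : ℝ≥0∞ := ENNReal.ofReal (M * L⁻¹) with hc
  refine ⟨2 * (shifts.card : ℝ≥0∞) * (CG : ℝ≥0∞) ^ 2 * (1 + c ^ 2), ?_, fun f hf hper => ?_⟩
  · refine ENNReal.mul_ne_top (ENNReal.mul_ne_top (ENNReal.mul_ne_top ENNReal.ofNat_ne_top
      (ENNReal.natCast_ne_top _)) (ENNReal.pow_ne_top ENNReal.coe_ne_top)) ?_
    exact ENNReal.add_ne_top.2 ⟨ENNReal.one_ne_top, ENNReal.pow_ne_top ENNReal.ofReal_ne_top⟩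
  set u : Space → ℂ := fun y => cutoff L y • f y with hu_def
  have hu : ContDiff ℝ 1 u := (contDiff_cutoff L).smul hf
  have h2u : HasCompactSupport u := (hasCompactSupport_cutoff hL.ne').smul_right
  have hn : 0 < Module.finrank ℝ Space := by rw [finrank_euclideanSpace_fin]; norm_num
  have hGNS := MeasureTheory.eLpNorm_le_eLpNorm_fderiv_of_eq_inner (μ := (volume : Measure Space))
    hu h2u (p := 2) (p' := 6) (by norm_num) hn
    (by rw [finrank_euclideanSpace_fin]; push_cast; norm_num)
  have hCG' : MeasureTheory.eLpNormLESNormFDerivOfEqInnerConst (volume : Measure Space) ((2 : ℝ≥0) : ℝ)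
      = CG := by rw [hCG, NNReal.coe_ofNat]
  rw [hCG'] at hGNS
  -- the two sides of GNS as lintegrals
  have h6 : eLpNorm u ((6 : ℝ≥0) : ℝ≥0∞) volume = (∫⁻ x, ‖u x‖ₑ ^ (6 : ℝ)) ^ (1 / (6 : ℝ)) := by
    rw [eLpNorm_nnreal_eq_lintegral (f := u) (μ := (volume : Measure Space)) (p := 6) (by norm_num)]
    norm_num
  have h2 : eLpNorm (fderiv ℝ u) ((2 : ℝ≥0) : ℝ≥0∞) volume =
      (∫⁻ x, ‖fderiv ℝ u x‖ₑ ^ 2) ^ (1 / (2 : ℝ)) := by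
    rw [eLpNorm_nnreal_eq_lintegral (f := fderiv ℝ u) (μ := (volume : Measure Space)) (p := 2)
      two_ne_zero]
    norm_num
  -- the left side: `f = u` on the cell
  have hleft : (∫⁻ x in cell L, (‖f x‖₊ : ℝ≥0∞) ^ (6 : ℝ)) ≤ ∫⁻ x, ‖u x‖ₑ ^ (6 : ℝ) := by
    calc (∫⁻ x in cell L, (‖f x‖₊ : ℝ≥0∞) ^ (6 : ℝ)) = ∫⁻ x in cell L, ‖u x‖ₑ ^ (6 : ℝ) := by
          refine setLIntegral_congr_fun (measurableSet_cell L) fun x hx => ?_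
          rw [hu_def]; dsimp only; rw [cutoff_eq_one hL hx, one_smul, enorm_eq_nnnorm]
      _ ≤ ∫⁻ x, ‖u x‖ₑ ^ (6 : ℝ) := setLIntegral_le_lintegral _ _
  -- the right side
  set I₁ : ℝ≥0∞ := ∫⁻ x in cell L, gradSqC f x with hI₁
  set I₂ : ℝ≥0∞ := ∫⁻ x in cell L, (‖f x‖₊ : ℝ≥0∞) ^ 2 with hI₂
  have hright : ∫⁻ x, ‖fderiv ℝ u x‖ₑ ^ 2 ≤ 2 * (shifts.card : ℝ≥0∞) * (I₁ + c ^ 2 * I₂) := by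
    have h := lintegral_sq_enorm_fderiv_cutoff_smul_le hL hf hper hM
    simp only [enorm_eq_nnnorm] at h ⊢
    exact h
  -- chain
  have hchain : (∫⁻ x in cell L, (‖f x‖₊ : ℝ≥0∞) ^ (6 : ℝ)) ^ (1 / (6 : ℝ)) ≤
      CG * (2 * (shifts.card : ℝ≥0∞) * (I₁ + c ^ 2 * I₂)) ^ (1 / (2 : ℝ)) := by
    calc (∫⁻ x in cell L, (‖f x‖₊ : ℝ≥0∞) ^ (6 : ℝ)) ^ (1 / (6 : ℝ))
        ≤ (∫⁻ x, ‖u x‖ₑ ^ (6 : ℝ)) ^ (1 / (6 : ℝ)) := ENNReal.rpow_le_rpow hleft (by norm_num)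
      _ = eLpNorm u ((6 : ℝ≥0) : ℝ≥0∞) volume := h6.symm
      _ ≤ CG * eLpNorm (fderiv ℝ u) ((2 : ℝ≥0) : ℝ≥0∞) volume := hGNS
      _ = CG * (∫⁻ x, ‖fderiv ℝ u x‖ₑ ^ 2) ^ (1 / (2 : ℝ)) := by rw [h2]
      _ ≤ CG * (2 * (shifts.card : ℝ≥0∞) * (I₁ + c ^ 2 * I₂)) ^ (1 / (2 : ℝ)) := by
          gcongr
  -- square both sides
  have hsq := ENNReal.rpow_le_rpow hchain (by norm_num : (0 : ℝ) ≤ 2)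
  rw [← ENNReal.rpow_mul, ENNReal.mul_rpow_of_nonneg _ _ (by norm_num : (0 : ℝ) ≤ 2), ← ENNReal.rpow_mul,
    show (1 / (6 : ℝ)) * 2 = 1 / 3 by norm_num, show (1 / (2 : ℝ)) * 2 = 1 by norm_num,
    ENNReal.rpow_one] at hsq
  refine hsq.trans ?_
  have hCG2 : (CG : ℝ≥0∞) ^ (2 : ℝ) = (CG : ℝ≥0∞) ^ 2 := by
    rw [← ENNReal.rpow_natCast]; norm_num
  rw [hCG2]
  calc (CG : ℝ≥0∞) ^ 2 * (2 * (shifts.card : ℝ≥0∞) * (I₁ + c ^ 2 * I₂))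
      ≤ (CG : ℝ≥0∞) ^ 2 * (2 * (shifts.card : ℝ≥0∞) * ((1 + c ^ 2) * (I₁ + I₂))) := by
        gcongr
        calc I₁ + c ^ 2 * I₂ = 1 * I₁ + c ^ 2 * I₂ := by rw [one_mul]
          _ ≤ (1 + c ^ 2) * I₁ + (1 + c ^ 2) * I₂ := by gcongr <;> simp
          _ = (1 + c ^ 2) * (I₁ + I₂) := by ring
    _ = 2 * (shifts.card : ℝ≥0∞) * (CG : ℝ≥0∞) ^ 2 * (1 + c ^ 2) * (I₁ + I₂) := by ring

end TorusSobolev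

open TorusSobolev

/-- **Weighted `L²` mass on the torus against the `H¹` norm** (registered helper of `stub_pairPotentialBound`).
For every side `L > 0` there is `C < ∞` such that for every measurable weight `W ≥ 0` on the cell and every
`Lℤ³`-periodic `C¹` function `f : ℝ³ → ℂ`,
`∫_cell W |f|² ≤ (∫_cell W^{3/2})^{2/3} · C (∫_cell |∇f|² + ∫_cell |f|²)`
(Hölder with exponents `3/2, 3` and the periodic Sobolev inequality `H¹(cell) ⊂ L⁶(cell)`,
`TorusSobolev.exists_lintegral_rpow_six_le`). [cite: LiebLoss2001, Thm. 8.3] -/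
theorem torusSobolev_weight_bound : ∀ L : ℝ, 0 < L → ∃ C : ℝ≥0∞, C ≠ ⊤ ∧ ∀ W : Literature.MathematicalPhysics.QuantumManyBody.BoseGas.Space → ℝ≥0∞, Measurable W → ∀ f : Literature.MathematicalPhysics.QuantumManyBody.BoseGas.Space → ℂ, ContDiff ℝ 1 f → (∀ (x : Literature.MathematicalPhysics.QuantumManyBody.BoseGas.Space) (k : Fin 3), f (x + EuclideanSpace.single k L) = f x) → (∫⁻ x in Literature.MathematicalPhysics.QuantumManyBody.BoseGas.cell L, W x * (‖f x‖₊ : ℝ≥0∞) ^ 2) ≤ (∫⁻ x in Literature.MathematicalPhysics.QuantumManyBody.BoseGas.cell L, W x ^ ((3 : ℝ) / 2)) ^ ((2 : ℝ) / 3) * (C * ((∫⁻ x in Literature.MathematicalPhysics.QuantumManyBody.BoseGas.cell L, Literature.MathematicalPhysics.QuantumManyBody.BoseGas.gradSqC f x) + ∫⁻ x in Literature.MathematicalPhysics.QuantumManyBody.BoseGas.cell L, (‖f x‖₊ : ℝ≥0∞) ^ 2)) := by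
  intro L hL
  obtain ⟨C, hC, hS⟩ := exists_lintegral_rpow_six_le hL
  refine ⟨C, hC, fun W hW f hf hper => ?_⟩
  have hpq : Real.HolderConjugate (3 / 2) 3 := Real.holderConjugate_iff.2 ⟨by norm_num, by norm_num⟩
  have hgm : Measurable fun x => (‖f x‖₊ : ℝ≥0∞) ^ 2 :=
    (hf.continuous.measurable.nnnorm.coe_nnreal_ennreal).pow_const _
  have h := ENNReal.lintegral_mul_le_Lp_mul_Lq (volume.restrict (cell L)) hpq hW.aemeasurable
    hgm.aemeasurable
  have e1 : (1 : ℝ) / (3 / 2) = 2 / 3 := by norm_num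
  have e3 : ∀ x : Space, ((‖f x‖₊ : ℝ≥0∞) ^ 2) ^ (3 : ℝ) = (‖f x‖₊ : ℝ≥0∞) ^ (6 : ℝ) := by
    intro x
    rw [← ENNReal.rpow_natCast, ← ENNReal.rpow_mul]
    norm_num
  simp only [Pi.mul_apply, e1, e3] at h
  refine h.trans ?_
  gcongr
  exact hS f hf hper

end Summit.AtomisticToContinuum.BoseEinsteinCondensation.Cruxes.GDTransfer.Seeded

end
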